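import Mathlib
import Literature.Computability.Complexity.TM2Disjunction
import Literature.Computability.Complexity.TimeBoundsProofs
import HarnessLib

/-!
# A two-way dispatch combinator on Mathlib's multi-stack machines (stub `stub_dispatch`)

`stub_dispatch` (line `birth` of crux `UniformStreamLB`): for Boolean TM2 machines `Ma`, `Mb` there
is ONE machine which on `false :: w` behaves as `Ma` on `w` and on `true :: w` as `Mb` on `w` (same
output word, in Mathlib's exact `Turing.haltList` convention), within `d (m + |w|) + d` steps for a
run of `m` steps, `d = 2 D + 5`, `D = TM2Comp.machinePushBound Mb.tm` — "case analysis in the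
finite control, then a subroutine" (Arora–Barak 2009, §1.3, Claim 1.6); a sibling of the tree's
disjunction machine `TM2Or.orTM` (`TM2Disjunction.lean`), whose auxiliary stacks `TM2Or.Aux`,
alphabets `TM2Or.OrΓ`, states `TM2Or.St` (lenses `set₁`/`set₂`, register helpers `rget`/`rst`)
and stack bookkeeping `TM2Or.mkStk` are reused. The machine `Dispatch.dispTM M₁ M₂ e₁ o₁ e₂ o₂`
(`e`/`o`: input/output alphabets `≃ Bool`): stacks `(M₁.K ⊕ M₂.K) ⊕ Aux`, input and output stacks
= those of `M₁`, `TMP` a transfer stack (`IN` idle); labels `(M₁.Λ ⊕ M₂.Λ) ⊕ Lbl`; states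
`M₁.σ × M₂.σ × Option Bool × Bool` (a symbol register; the bit is unused). `start` pops the tag.
On `false` it jumps to `M₁.main`: the statements of `M₁`, lifted along `inl ∘ inl` by
`TM2Lift.liftStmt` with `halt ↦ halt`, run `M₁` IN PLACE and its `haltList` configuration is the
dispatch machine's one (`m + 1` steps). On `true`: `pour` moves the input (read through `e₁`) to
`TMP`, `feed` moves `TMP` onto the input stack of `M₂` (through `e₂.symm`; the two reversals
restore the order) and jumps to `M₂.main` (statements lifted along `inl ∘ inr`,
`halt ↦ goto out`); `M₂` halting in `haltList` form, `out` moves its output stack (read through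
`o₂`) to `TMP` and `emit` moves `TMP` onto the output stack of `M₁` (through `o₁.symm`), resets
the state and halts: `m + 2 |w| + 2 |out| + 5` steps, `|out| ≤ |w| + D m`
(`TM2Comp.length_le_of_outputsWithin`). Proofs as in `TM2Disjunction.lean`: configurations
`Dispatch.dcfg`, one `simp` per control step, phases by induction on the moved word, runs of
`M₁`/`M₂` by `TM2Lift.iterate_lift`, chaining by `TM2Iter.ReachesIn`.
References: S. Arora, B. Barak, *Computational Complexity: A Modern Approach*, CUP 2009, §1.3
(machine constructions: subroutines on multi-tape machines), Claim 1.6,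
doi:10.1017/cbo9780511804090; Mathlib, `Mathlib/Computability/TuringMachine/Computable.lean`.
-/

set_option linter.dupNamespace false -- summit = sub-problem (D-0017)

noncomputable section

namespace Summit.PneNP.PneNP.Theorems.UniformStreamLB.Birth

namespace Dispatch

open Turing StateTransition Function
open Literature.Computability.Complexity Literature.Computability.Complexity.TM2Or
  Literature.Computability.Complexity.TM2Lift Literature.Computability.Complexity.TM2Comp

/-- The control labels of the dispatch machine (besides those of the two machines). [folklore] -/
inductive Lbl
  | start | pour | feed | out | emit
  deriving DecidableEq, Fintype

section Machine

variable {K₁ K₂ : Type} {G₁ : K₁ → Type} {G₂ : K₂ → Type} {Λ₁ Λ₂ σ₁ σ₂ : Type}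

/-- Move loop: pop stack `k` (read through `f`) into the symbol register; on an empty stack
continue with `next`, else push the symbol (through `g`) on `k'`, reset the register and jump back
to the control label `self`. [folklore] -/
def mv (k k' : (K₁ ⊕ K₂) ⊕ Aux) (f : OrΓ G₁ G₂ Bool k → Bool) (g : Bool → OrΓ G₁ G₂ Bool k')
    (self : Lbl) (next : TM2.Stmt (OrΓ G₁ G₂ Bool) ((Λ₁ ⊕ Λ₂) ⊕ Lbl) (St σ₁ σ₂ Bool)) :
    TM2.Stmt (OrΓ G₁ G₂ Bool) ((Λ₁ ⊕ Λ₂) ⊕ Lbl) (St σ₁ σ₂ Bool) :=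
  TM2.Stmt.pop k (fun v a => (v.1, v.2.1, a.map f, v.2.2.2)) <|
    TM2.Stmt.branch (fun v => v.2.2.1.isNone) next
      (TM2.Stmt.push k' (fun v => g (rget v)) <| TM2.Stmt.load rst <|
        TM2.Stmt.goto fun _ => Sum.inr self)

variable (k₀₁ k₁₁ : K₁) (k₀₂ k₁₂ : K₂) (e₁ : G₁ k₀₁ ≃ Bool) (o₁ : G₁ k₁₁ ≃ Bool)
  (e₂ : G₂ k₀₂ ≃ Bool) (o₂ : G₂ k₁₂ ≃ Bool) (main₁ : Λ₁) (main₂ : Λ₂) (init₁ : σ₁) (init₂ : σ₂)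

/-- The control statements (see the module docstring): `start` pops the tag from the input stack
of `M₁` and branches; `pour`/`feed`/`out`/`emit` are move loops; `emit` ends by resetting the
whole state and halting. [folklore] -/
def ctrl : Lbl → TM2.Stmt (OrΓ G₁ G₂ Bool) ((Λ₁ ⊕ Λ₂) ⊕ Lbl) (St σ₁ σ₂ Bool)
  | Lbl.start =>
      TM2.Stmt.pop (Sum.inl (Sum.inl k₀₁)) (fun v a => (v.1, v.2.1, a.map e₁, v.2.2.2)) <|
        TM2.Stmt.branch (fun v => rget v)
          (TM2.Stmt.load rst <| TM2.Stmt.goto fun _ => Sum.inr Lbl.pour)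
          (TM2.Stmt.load rst <| TM2.Stmt.goto fun _ => Sum.inl (Sum.inl main₁))
  | Lbl.pour => mv (Sum.inl (Sum.inl k₀₁)) (Sum.inr Aux.TMP) e₁ id Lbl.pour
      (TM2.Stmt.load rst <| TM2.Stmt.goto fun _ => Sum.inr Lbl.feed)
  | Lbl.feed => mv (Sum.inr Aux.TMP) (Sum.inl (Sum.inr k₀₂)) id e₂.symm Lbl.feed
      (TM2.Stmt.load rst <| TM2.Stmt.goto fun _ => Sum.inl (Sum.inr main₂))
  | Lbl.out => mv (Sum.inl (Sum.inr k₁₂)) (Sum.inr Aux.TMP) o₂ id Lbl.out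
      (TM2.Stmt.load rst <| TM2.Stmt.goto fun _ => Sum.inr Lbl.emit)
  | Lbl.emit => mv (Sum.inr Aux.TMP) (Sum.inl (Sum.inl k₁₁)) id o₁.symm Lbl.emit
      (TM2.Stmt.load (fun _ => (init₁, init₂, none, false)) TM2.Stmt.halt)

end Machine

section Bundled

variable (M₁ M₂ : FinTM2) (e₁ : M₁.Γ M₁.k₀ ≃ Bool) (o₁ : M₁.Γ M₁.k₁ ≃ Bool)
  (e₂ : M₂.Γ M₂.k₀ ≃ Bool) (o₂ : M₂.Γ M₂.k₁ ≃ Bool)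

/-- The (unbundled) type of configurations of the dispatch machine. [folklore] -/
abbrev DCfg : Type := TM2.Cfg (OrΓ M₁.Γ M₂.Γ Bool) ((M₁.Λ ⊕ M₂.Λ) ⊕ Lbl) (St M₁.σ M₂.σ Bool)

/-- Configurations between control steps: label `l`, both machine states initial, registers
reset, stacks `S₁` of `M₁`, `S₂` of `M₂`, `IN` idle, `TMP = t`. [folklore] -/
def dcfg (l : Option ((M₁.Λ ⊕ M₂.Λ) ⊕ Lbl)) (S₁ : ∀ k, List (M₁.Γ k)) (S₂ : ∀ k, List (M₂.Γ k))
    (t : List Bool) : DCfg M₁ M₂ :=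
  ⟨l, (M₁.initialState, M₂.initialState, none, false), mkStk S₁ S₂ [] t⟩

/-- The program of the dispatch machine: lifted statements of `M₁` (`halt ↦ halt`), lifted
statements of `M₂` (`halt ↦ goto out`), control statements. [folklore] -/
def dispStmt : (M₁.Λ ⊕ M₂.Λ) ⊕ Lbl →
    TM2.Stmt (OrΓ M₁.Γ M₂.Γ Bool) ((M₁.Λ ⊕ M₂.Λ) ⊕ Lbl) (St M₁.σ M₂.σ Bool)
  | Sum.inl (Sum.inl l) => liftStmt (Γ' := OrΓ M₁.Γ M₂.Γ Bool) (fun k => Sum.inl (Sum.inl k))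
      (fun l => Sum.inl (Sum.inl l)) none (fun v => v.1) set₁ (M₁.m l)
  | Sum.inl (Sum.inr l) => liftStmt (Γ' := OrΓ M₁.Γ M₂.Γ Bool) (fun k => Sum.inl (Sum.inr k))
      (fun l => Sum.inl (Sum.inr l)) (some (Sum.inr Lbl.out)) (fun v => v.2.1) set₂ (M₂.m l)
  | Sum.inr c => ctrl M₁.k₀ M₁.k₁ M₂.k₀ M₂.k₁ e₁ o₁ e₂ o₂ M₁.main M₂.main
      M₁.initialState M₂.initialState c

/-- The dispatch machine of two bundled TM2 machines `M₁`, `M₂` over `{0,1}`: stacks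
`(M₁.K ⊕ M₂.K) ⊕ Aux` (input and output stacks those of `M₁`), labels `(M₁.Λ ⊕ M₂.Λ) ⊕ Lbl`
(main label `start`), states `M₁.σ × M₂.σ × Option Bool × Bool`.
[cite: AroraBarak2009, §1.3 (multi-tape machine constructions; subroutines)] -/
noncomputable def dispTM : FinTM2 :=
  letI := M₁.kFin; letI := M₁.ΛFin; letI := M₁.σFin
  letI := M₂.kFin; letI := M₂.ΛFin; letI := M₂.σFin
  { K := (M₁.K ⊕ M₂.K) ⊕ Aux, k₀ := Sum.inl (Sum.inl M₁.k₀), k₁ := Sum.inl (Sum.inl M₁.k₁)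
    Γ := OrΓ M₁.Γ M₂.Γ Bool, Λ := (M₁.Λ ⊕ M₂.Λ) ⊕ Lbl, main := Sum.inr Lbl.start
    σ := St M₁.σ M₂.σ Bool, initialState := (M₁.initialState, M₂.initialState, none, false)
    Γk₀Fin := M₁.Γk₀Fin, m := dispStmt M₁ M₂ e₁ o₁ e₂ o₂ }

local notation "𝔻" => dispTM M₁ M₂ e₁ o₁ e₂ o₂
local notation "ℭ" => dcfg M₁ M₂

/-- A step of the dispatch machine at a control label, unbundled. [folklore] -/
theorem step_inr (c : Lbl) (var : St M₁.σ M₂.σ Bool) (stk : ∀ j, List (OrΓ M₁.Γ M₂.Γ Bool j)) :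
    (𝔻).step (⟨some (Sum.inr c), var, stk⟩ : DCfg M₁ M₂) =
      some (TM2.stepAux (ctrl M₁.k₀ M₁.k₁ M₂.k₀ M₂.k₁ e₁ o₁ e₂ o₂ M₁.main M₂.main
        M₁.initialState M₂.initialState c) var stk) := rfl

section Phases

variable (S₁ : ∀ k, List (M₁.Γ k)) (S₂ : ∀ k, List (M₂.Γ k))

/-- `start` on tag `false`: pop it and jump to the main label of `M₁`. [folklore] -/
theorem step_start_false (L : List (M₁.Γ M₁.k₀)) (t : List Bool) :
    (𝔻).step (ℭ (some (Sum.inr Lbl.start)) (update S₁ M₁.k₀ (e₁.symm false :: L)) S₂ t) =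
      some (ℭ (some (Sum.inl (Sum.inl M₁.main))) (update S₁ M₁.k₀ L) S₂ t) := by
  rw [dcfg, step_inr]; simp [ctrl, rst, rget, dcfg]

/-- `start` on tag `true`: pop it and proceed to `pour`. [folklore] -/
theorem step_start_true (L : List (M₁.Γ M₁.k₀)) (t : List Bool) :
    (𝔻).step (ℭ (some (Sum.inr Lbl.start)) (update S₁ M₁.k₀ (e₁.symm true :: L)) S₂ t) =
      some (ℭ (some (Sum.inr Lbl.pour)) (update S₁ M₁.k₀ L) S₂ t) := by
  rw [dcfg, step_inr]; simp [ctrl, rst, rget, dcfg]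

/-- `pour`: the input stack of `M₁` is moved (reversed, read through `e₁`) onto `TMP`, then the
machine proceeds to `feed`. [folklore] -/
theorem pour_run (L : List (M₁.Γ M₁.k₀)) (t : List Bool) :
    TM2Iter.ReachesIn (C := DCfg M₁ M₂) (𝔻).step
      (ℭ (some (Sum.inr Lbl.pour)) (update S₁ M₁.k₀ L) S₂ t)
      (ℭ (some (Sum.inr Lbl.feed)) (update S₁ M₁.k₀ []) S₂ (L.reverse.map e₁ ++ t))
      (L.length + 1) := by
  induction L generalizing t with
  | nil =>
    refine TM2Iter.ReachesIn.single ?_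
    rw [dcfg, step_inr]; simp [ctrl, mv, rst, dcfg]
  | cons g L ih =>
    have h := TM2Iter.ReachesIn.step_trans
      (a := ℭ (some (Sum.inr Lbl.pour)) (update S₁ M₁.k₀ (g :: L)) S₂ t)
      (by rw [dcfg, step_inr]; simp [ctrl, mv, rst, rget, dcfg]) (ih (e₁ g :: t))
    simpa [List.append_assoc] using h

/-- `feed`: `TMP` is moved (reversed, through `e₂.symm`) on top of the input stack of `M₂`, then
the machine jumps to the main label of `M₂`. [folklore] -/
theorem feed_run (t : List Bool) :
    TM2Iter.ReachesIn (C := DCfg M₁ M₂) (𝔻).step (ℭ (some (Sum.inr Lbl.feed)) S₁ S₂ t)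
      (ℭ (some (Sum.inl (Sum.inr M₂.main))) S₁
        (update S₂ M₂.k₀ (t.reverse.map e₂.symm ++ S₂ M₂.k₀)) []) (t.length + 1) := by
  induction t generalizing S₂ with
  | nil =>
    rw [update_eq_self_iff.mpr (by simp)]
    refine TM2Iter.ReachesIn.single ?_
    rw [dcfg, step_inr]; simp [ctrl, mv, rst, dcfg]
  | cons s t ih =>
    have h := TM2Iter.ReachesIn.step_trans (a := ℭ (some (Sum.inr Lbl.feed)) S₁ S₂ (s :: t))
      (b := ℭ (some (Sum.inr Lbl.feed)) S₁ (update S₂ M₂.k₀ (e₂.symm s :: S₂ M₂.k₀)) t)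
      (by rw [dcfg, step_inr]; simp [ctrl, mv, rst, rget, dcfg]) (ih _)
    rw [update_idem, update_self] at h
    simpa [List.append_assoc] using h

/-- `out`: the output stack of `M₂` is moved (reversed, read through `o₂`) onto `TMP`, then the
machine proceeds to `emit`. [folklore] -/
theorem out_run (L : List (M₂.Γ M₂.k₁)) (t : List Bool) :
    TM2Iter.ReachesIn (C := DCfg M₁ M₂) (𝔻).step
      (ℭ (some (Sum.inr Lbl.out)) S₁ (update S₂ M₂.k₁ L) t)
      (ℭ (some (Sum.inr Lbl.emit)) S₁ (update S₂ M₂.k₁ []) (L.reverse.map o₂ ++ t))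
      (L.length + 1) := by
  induction L generalizing t with
  | nil =>
    refine TM2Iter.ReachesIn.single ?_
    rw [dcfg, step_inr]; simp [ctrl, mv, rst, dcfg]
  | cons g L ih =>
    have h := TM2Iter.ReachesIn.step_trans
      (a := ℭ (some (Sum.inr Lbl.out)) S₁ (update S₂ M₂.k₁ (g :: L)) t)
      (by rw [dcfg, step_inr]; simp [ctrl, mv, rst, rget, dcfg]) (ih (o₂ g :: t))
    simpa [List.append_assoc] using h

/-- `emit`: `TMP` is moved (reversed, through `o₁.symm`) on top of the output stack of `M₁`, then
the state is reset and the machine halts. [folklore] -/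
theorem emit_run (t : List Bool) :
    TM2Iter.ReachesIn (C := DCfg M₁ M₂) (𝔻).step (ℭ (some (Sum.inr Lbl.emit)) S₁ S₂ t)
      (ℭ none (update S₁ M₁.k₁ (t.reverse.map o₁.symm ++ S₁ M₁.k₁)) S₂ []) (t.length + 1) := by
  induction t generalizing S₁ with
  | nil =>
    rw [update_eq_self_iff.mpr (by simp)]
    refine TM2Iter.ReachesIn.single ?_
    rw [dcfg, step_inr]; simp [ctrl, mv, dcfg]
  | cons s t ih =>
    have h := TM2Iter.ReachesIn.step_trans (a := ℭ (some (Sum.inr Lbl.emit)) S₁ S₂ (s :: t))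
      (b := ℭ (some (Sum.inr Lbl.emit)) (update S₁ M₁.k₁ (o₁.symm s :: S₁ M₁.k₁)) S₂ t)
      (by rw [dcfg, step_inr]; simp [ctrl, mv, rst, rget, dcfg]) (ih _)
    rw [update_idem, update_self] at h
    simpa [List.append_assoc] using h

end Phases

/-- A run of `M₁` from `initList` to `haltList` is, in place, a run of the dispatch machine from
the main label of `M₁` to its own halting configuration (`halt ↦ halt`). [folklore] -/
theorem runA {n : ℕ} {x : List (M₁.Γ M₁.k₀)} {y : List (M₁.Γ M₁.k₁)}
    (h : (flip bind M₁.step)^[n] (some (initList M₁ x)) = some (haltList M₁ y)) :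
    (flip bind (𝔻).step)^[n]
        (some (ℭ (some (Sum.inl (Sum.inl M₁.main))) (update (fun _ => []) M₁.k₀ x) (fun _ => []) []))
      = some (ℭ none (update (fun _ => []) M₁.k₁ y) (fun _ => []) []) := by
  have hemb : Embeds (Γ' := OrΓ M₁.Γ M₂.Γ Bool) (fun k => Sum.inl (Sum.inl k))
      (fun l => Sum.inl (Sum.inl l)) none set₁
      ((M₁.initialState, M₂.initialState, none, false) : St M₁.σ M₂.σ Bool)
      (mkStk (fun _ => []) (fun _ => []) [] []) (initList M₁ x)
      (ℭ (some (Sum.inl (Sum.inl M₁.main))) (update (fun _ => []) M₁.k₀ x) (fun _ => []) []) := by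
    rw [initList_eq]
    exact ⟨rfl, rfl, fun _ => rfl, fun j hj => by
      rcases j with (k | k) | a
      · exact absurd rfl (hj k)
      · rfl
      · cases a <;> rfl⟩
  obtain ⟨⟨dl, dv, dS⟩, hd', h1, h2, h3, h4⟩ := iterate_lift (Γ' := OrΓ M₁.Γ M₂.Γ Bool)
    (κ := fun k => Sum.inl (Sum.inl k)) (fun l => Sum.inl (Sum.inl l)) none
    (inl_inl_injective M₁ M₂) lens₁ (m := M₁.m) (m' := dispStmt M₁ M₂ e₁ o₁ e₂ o₂)
    (fun _ => rfl) n hemb h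
  rw [haltList_eq] at h1 h2 h3; simp only [liftLabel] at h1 h2 h3
  subst h1 h2
  refine hd'.trans ?_
  rw [dcfg]; congr; funext j
  rcases j with (k | k) | a
  · exact h3 k
  · exact h4 (Sum.inl (Sum.inr k)) (fun k' h => by simp at h)
  · cases a <;> exact h4 (Sum.inr _) (fun k' h => by simp at h)

/-- A run of `M₂` from `initList` to `haltList` is a run of the dispatch machine from the main
label of `M₂` (input on its input stack, its other stacks empty) to `out` (output on its output
stack, its other stacks empty), the rest being untouched. [folklore] -/
theorem runB {n : ℕ} {x : List (M₂.Γ M₂.k₀)} {y : List (M₂.Γ M₂.k₁)}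
    (h : (flip bind M₂.step)^[n] (some (initList M₂ x)) = some (haltList M₂ y)) :
    (flip bind (𝔻).step)^[n]
        (some (ℭ (some (Sum.inl (Sum.inr M₂.main))) (fun _ => []) (update (fun _ => []) M₂.k₀ x) []))
      = some (ℭ (some (Sum.inr Lbl.out)) (fun _ => []) (update (fun _ => []) M₂.k₁ y) []) := by
  have hemb : Embeds (Γ' := OrΓ M₁.Γ M₂.Γ Bool) (fun k => Sum.inl (Sum.inr k))
      (fun l => Sum.inl (Sum.inr l)) (some (Sum.inr Lbl.out)) set₂
      ((M₁.initialState, M₂.initialState, none, false) : St M₁.σ M₂.σ Bool)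
      (mkStk (fun _ => []) (fun _ => []) [] []) (initList M₂ x)
      (ℭ (some (Sum.inl (Sum.inr M₂.main))) (fun _ => []) (update (fun _ => []) M₂.k₀ x) []) := by
    rw [initList_eq]
    exact ⟨rfl, rfl, fun _ => rfl, fun j hj => by
      rcases j with (k | k) | a
      · rfl
      · exact absurd rfl (hj k)
      · cases a <;> rfl⟩
  obtain ⟨⟨dl, dv, dS⟩, hd', h1, h2, h3, h4⟩ := iterate_lift (Γ' := OrΓ M₁.Γ M₂.Γ Bool)
    (κ := fun k => Sum.inl (Sum.inr k)) (fun l => Sum.inl (Sum.inr l)) (some (Sum.inr Lbl.out))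
    (inl_inr_injective M₁ M₂) lens₂ (m := M₂.m) (m' := dispStmt M₁ M₂ e₁ o₁ e₂ o₂)
    (fun _ => rfl) n hemb h
  rw [haltList_eq] at h1 h2 h3; simp only [liftLabel] at h1 h2 h3
  subst h1 h2
  refine hd'.trans ?_
  rw [dcfg]; congr; funext j
  rcases j with (k | k) | a
  · exact h4 (Sum.inl (Sum.inl k)) (fun k' h => by simp at h)
  · exact h3 k
  · cases a <;> exact h4 (Sum.inr _) (fun k' h => by simp at h)

/-- The initial configuration of the dispatch machine. [folklore] -/
theorem initList_dispTM (l : List (M₁.Γ M₁.k₀)) : initList (𝔻) l =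
    ℭ (some (Sum.inr Lbl.start)) (update (fun _ => []) M₁.k₀ l) (fun _ => []) [] := by
  rw [initList_eq]
  change (⟨some (Sum.inr Lbl.start), (M₁.initialState, M₂.initialState, none, false),
    update (fun j => ([] : List (OrΓ M₁.Γ M₂.Γ Bool j))) (Sum.inl (Sum.inl M₁.k₀)) l⟩ :
      DCfg M₁ M₂) = _
  rw [← mkStk_bot, mkStk_update_inl_inl]
  rfl

/-- The halting configuration of the dispatch machine. [folklore] -/
theorem haltList_dispTM (l : List (M₁.Γ M₁.k₁)) :
    haltList (𝔻) l = ℭ none (update (fun _ => []) M₁.k₁ l) (fun _ => []) [] := by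
  rw [haltList_eq]
  change (⟨none, (M₁.initialState, M₂.initialState, none, false),
    update (fun j => ([] : List (OrΓ M₁.Γ M₂.Γ Bool j))) (Sum.inl (Sum.inl M₁.k₁)) l⟩ :
      DCfg M₁ M₂) = _
  rw [← mkStk_bot, mkStk_update_inl_inl]
  rfl

/-- **The dispatch machine on tag `false`, unbundled form.** A run of `M₁` from `x` to `y`
within `m₁` steps is a run of the dispatch machine from `e₁.symm false :: x` to `y` within
`m₁ + 1` steps. [cite: AroraBarak2009, §1.3 (multi-tape machine constructions; subroutines)] -/
theorem dispTM_run_false (x : List (M₁.Γ M₁.k₀)) (y : List (M₁.Γ M₁.k₁)) (m₁ : ℕ)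
    (h₁ : TM2Iter.ReachesIn M₁.step (initList M₁ x) (haltList M₁ y) m₁) :
    TM2Iter.ReachesIn (𝔻).step (initList (𝔻) (e₁.symm false :: x)) (haltList (𝔻) y)
      (m₁ + 1) := by
  obtain ⟨n₁, hn₁, r₁⟩ := h₁
  rw [initList_dispTM, haltList_dispTM]
  exact TM2Iter.ReachesIn.step_trans
    (step_start_false M₁ M₂ e₁ o₁ e₂ o₂ (fun _ => []) (fun _ => []) x [])
    ⟨n₁, hn₁, runA M₁ M₂ e₁ o₁ e₂ o₂ r₁⟩

/-- **The dispatch machine on tag `true`, unbundled form.** If `M₂` maps `x.map e₂.symm` to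
`y.map o₂.symm` within `m₂` steps (`initList` to `haltList`), then the dispatch machine maps
`(true :: x).map e₁.symm` to `y.map o₁.symm` within `m₂ + 2 |x| + 2 |y| + 5` steps.
[cite: AroraBarak2009, §1.3 (multi-tape machine constructions; subroutines)] -/
theorem dispTM_run_true (x y : List Bool) (m₂ : ℕ) (h₂ : TM2Iter.ReachesIn M₂.step
      (initList M₂ (x.map e₂.symm)) (haltList M₂ (y.map o₂.symm)) m₂) :
    TM2Iter.ReachesIn (𝔻).step (initList (𝔻) (e₁.symm true :: x.map e₁.symm))
      (haltList (𝔻) (y.map o₁.symm)) (m₂ + 2 * x.length + 2 * y.length + 5) := by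
  obtain ⟨n₂, hn₂, r₂⟩ := h₂
  rw [initList_dispTM, haltList_dispTM]
  have s0 := TM2Iter.ReachesIn.single
    (step_start_true M₁ M₂ e₁ o₁ e₂ o₂ (fun _ => []) (fun _ => []) (x.map e₁.symm) [])
  have s1 := pour_run M₁ M₂ e₁ o₁ e₂ o₂ (fun _ => []) (fun _ => []) (x.map e₁.symm) []
  have e1 : ((x.map e₁.symm).reverse.map e₁ ++ [] : List Bool) = x.reverse := by
    simp [List.map_reverse]
  rw [update_bot_nil, e1, List.length_map] at s1
  have s2 := feed_run M₁ M₂ e₁ o₁ e₂ o₂ (fun _ => []) (fun _ => []) x.reverse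
  simp only [List.append_nil, List.reverse_reverse, List.length_reverse] at s2
  have s3 : TM2Iter.ReachesIn (C := DCfg M₁ M₂) (𝔻).step _ _ n₂ :=
    ⟨n₂, le_rfl, runB M₁ M₂ e₁ o₁ e₂ o₂ r₂⟩
  have s4 := out_run M₁ M₂ e₁ o₁ e₂ o₂ (fun _ => []) (fun _ => []) (y.map o₂.symm) []
  have e4 : ((y.map o₂.symm).reverse.map o₂ ++ [] : List Bool) = y.reverse := by
    simp [List.map_reverse]
  rw [update_bot_nil, e4, List.length_map] at s4
  have s5 := emit_run M₁ M₂ e₁ o₁ e₂ o₂ (fun _ => []) (fun _ => []) y.reverse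
  simp only [List.append_nil, List.reverse_reverse, List.length_reverse] at s5
  have := ((((s0.trans s1).trans s2).trans s3).trans s4).trans s5
  exact this.mono (by omega)

end Bundled

end Dispatch

open Turing Literature.Computability.Complexity Literature.Computability.Complexity.TM2Comp
  Literature.Computability.Complexity.TM2Iter Dispatch

/-- The dispatch machine of `Ma Mb : TM2ComputableAux Bool Bool` (`Dispatch.dispTM` with their
input/output alphabets; the input and output stacks of `Ma` serve as its own), a sibling of the
tree's `TM2ComputableAux.orMachine`. [cite: AroraBarak2009, §1.3 (multi-tape machines; subroutines)] -/
noncomputable def dispatchMachine (Ma Mb : TM2ComputableAux Bool Bool) :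
    TM2ComputableAux Bool Bool :=
  ⟨dispTM Ma.tm Mb.tm Ma.inputAlphabet Ma.outputAlphabet Mb.inputAlphabet Mb.outputAlphabet,
    Ma.inputAlphabet, Ma.outputAlphabet⟩

/-- **Stub A of line `birth` (dispatch combinator).** For any two Boolean `TM2` machines there is
one machine which on `false :: w` behaves as the first on `w` and on `true :: w` as the second,
delivering that machine's output in Mathlib's `haltList` convention, with linear overhead
`d (m + |w|) + d`, `d = 2 D + 5` (`D` the push bound of the second machine; its output has length
`≤ |w| + D m`, `TM2Comp.length_le_of_outputsWithin`). [Arora–Barak 2009, §1.3 (machines as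
subroutines), Claim 1.6; cf. tree `TM2Disjunction.lean`] [cite: AroraBarak2009, §1.3] -/
theorem stub_dispatch :
    ∀ (Ma Mb : Turing.TM2ComputableAux Bool Bool),
      ∃ (M : Turing.TM2ComputableAux Bool Bool) (d : ℕ),
        ∀ (w out : List Bool) (m : ℕ),
          (Ma.OutputsWithin w out m → M.OutputsWithin (false :: w) out (d * (m + w.length) + d)) ∧
          (Mb.OutputsWithin w out m → M.OutputsWithin (true :: w) out (d * (m + w.length) + d)) := by
  intro Ma Mb
  refine ⟨dispatchMachine Ma Mb, 2 * machinePushBound Mb.tm + 5, fun w out m => ⟨fun h => ?_,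
    fun h => ?_⟩⟩
  · have H : (dispatchMachine Ma Mb).OutputsWithin (false :: w) out (m + 1) :=
      outputsWithin_of_reachesIn _ (dispTM_run_false Ma.tm Mb.tm Ma.inputAlphabet
        Ma.outputAlphabet Mb.inputAlphabet Mb.outputAlphabet _ _ m (reachesIn_of_outputsWithin Ma h))
    have : 1 * (m + w.length) ≤ (2 * machinePushBound Mb.tm + 5) * (m + w.length) :=
      Nat.mul_le_mul_right _ (by omega)
    exact H.mono (by omega)
  · have H : (dispatchMachine Ma Mb).OutputsWithin (true :: w) out
        (m + 2 * w.length + 2 * out.length + 5) :=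
      outputsWithin_of_reachesIn _ (dispTM_run_true Ma.tm Mb.tm Ma.inputAlphabet Ma.outputAlphabet
        Mb.inputAlphabet Mb.outputAlphabet w out m (reachesIn_of_outputsWithin Mb h))
    have h1 := length_le_of_outputsWithin Mb h
    have h2 : (2 * machinePushBound Mb.tm + 5) * (m + w.length) = 2 * (machinePushBound Mb.tm * m)
        + 5 * m + 2 * (machinePushBound Mb.tm * w.length) + 5 * w.length := by ring
    exact H.mono (by omega)

end Summit.PneNP.PneNP.Theorems.UniformStreamLB.Birth
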